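import Summits.AtomisticToContinuum.Crystallization.Theorems.FrustratedLawDichotomyTransportPriceDoor

/-!
# FrustratedLawDichotomy · crux `AperiodicFrustratedLawGap` (stmt-AtomisticToContinuum-27623) — THE SIGNED LEDGER JUNCTION
# (decomp-a2c, RESIDUAL lens-5 «finite/base range + asymptotic regime + bridge», generation 109; T-side, branch E′ «ledger first»)

The tree's transport lemma (`…TransportPrice.lt_integral_rootEnergy_of_transport`) prices ONE non-negative covariant transport `F` and asks for a
POINTWISE almost-sure price `e⋆ < rootEnergy μ + in_F μ − out_F μ`.  The E′ ledger (g107 MECHANISM-T §E, g108 AvgLedger, critic r1664 (C3) «AVERAGE,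
DON'T BOUND») needs two more degrees of freedom, both folklore and both supplied here at TREE level:

* §1 **signed transports** `F − G` (first-variation transports are signed: a chartable root sends `½ φ′(|B|) B̂·(u_k + u_j)` along each window bond, of
  either sign) — `integral_net_eq_zero` (the net signed flow `net F G = (in_F − in_G) − (out_F − out_G)` is integrable with mean zero: the mass-transport
  principle applied to `F` and to `G`), `lt_integral_rootEnergy_of_meanSignedPrice` (**a price IN THE MEAN suffices**: `c < E_P[rootEnergy + net] ⇒
  c < E_P[rootEnergy]`) and its pointwise corollary `lt_integral_rootEnergy_of_signedTransport`;
* §3 **the law-level ledger** `LawLedger P c`: a measurable set of GOOD (chartable) roots, a host-gap floor `γ` booked at good roots and a surplus floor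
  `σ` at bad roots AFTER redistribution, up to non-negative… (no sign needed) integrable charges `q` (second order + chart mismatch at good roots) and `r`
  (interface flux landing at bad roots), and ONE averaged inequality `AvgCoercivity`: the mean charges are strictly below the booked credit
  `γ·P(good) + σ·P(bad)`.  `LawLedger.lt_integral_rootEnergy` : any ledger forces `c < E_P[rootEnergy]` (integrate the two floors, cancel the net flow by §1).
  This DISCHARGES g108's abstract hypothesis `TransportBalanced` (it is the mass-transport identity) and replaces its Reading-2 budget
  (GoodGapFloor ∧ MismatchControl ∧ BadInflowFloor ∧ AvgCoercivity ∧ BadSurplusFloor) by the two pointwise floors + one mean inequality they imply.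

§2/§4 are the BY-NAME DOORS for the route decl: `aperiodicFrustratedLawGap_of_lawSignedTransportPrice` (pointwise signed price),
`aperiodicFrustratedLawGap_of_lawMeanSignedPrice` (price in the mean) and `aperiodicFrustratedLawGap_of_lawLedger` (a `LawLedger P e⋆` for every admissible
minimising law) — verbatim copies of the tree door `…TransportPriceDoor.aperiodicFrustratedLawGap_of_lawTransportPrice` with the price clause replaced.

What is NOT here (owed, E-side / H-side): the CONSTRUCTION of a ledger for admissible laws — `γ` = the host-gap floor of 1/20-bad-1/8-good sites (GOOD49),
`σ` = the H-side surplus at 1/8-bad roots, `q`/`r` and the coercivity inequality = the local-stiffness DUAL certificates of MU-LOC-109 (lens-5 g109 desk: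
the interface flux costs 0.005–0.013 per bad site in energy currency under the FLUX-108 convention, below the host gap on strained hosts; a modulus-floor
certificate is false, μ_loc = 0.02–0.08).  Tags: §1 [folklore: mass-transport principle, AldousLyons2007 §2, LastPenrose2017 Ch. 9]; §3 [new: bookkeeping only].
-/

noncomputable section

namespace Summit.AtomisticToContinuum.Crystallization.Theorems.FrustratedLawDichotomySignedLedger

open MeasureTheory Metric Set Filter
open scoped ENNReal Topology BigOperators
open Literature.MathematicalPhysics.StatisticalMechanics Literature.Probability.Process
open Summit.AtomisticToContinuum.Crystallization.Theorems.ChargedEnergyGapNegative (E3 eStar)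
open Summit.AtomisticToContinuum.Crystallization.Theorems.FrustratedLawDichotomyFiniteClusterGap (integrable_rootEnergy_of_ae_hardCore)
open Summit.AtomisticToContinuum.Crystallization.Theorems.FrustratedLawDichotomyTransportPrice (integral_inflow_toReal_eq)

variable {δ : ℝ} {P : Measure (Measure E3)} {F G : Measure E3 → E3 → ℝ≥0∞}

/-! ## §1. Signed transports: the net flow has mean zero; a price in the mean suffices -/

/-- The NET signed flow at the root of the signed covariant transport `F − G` (both parts non-negative kernels):
`(in_F − in_G) − (out_F − out_G)`, real parts. -/
def net (F G : Measure E3 → E3 → ℝ≥0∞) (μ : Measure E3) : ℝ :=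
  ((∫⁻ y, F (μ.map fun z => z - y) (-y) ∂μ).toReal - (∫⁻ y, G (μ.map fun z => z - y) (-y) ∂μ).toReal) -
    ((∫⁻ y, F μ y ∂μ).toReal - (∫⁻ y, G μ y ∂μ).toReal)

/-- **Signed mass transport.**  For a point-stationary law almost surely carried by rooted `δ`-hard-core configurations and two jointly measurable
covariant transports `F`, `G` of finite mean out-flow, the net signed flow `net F G` is integrable and has MEAN ZERO. [folklore] -/
theorem integral_net_eq_zero (hδ : 0 < δ) (hcore : ∀ᵐ μ ∂P, IsRootedHardCore δ μ) (hstat : IsPointStationaryLaw P)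
    (hF : Measurable (Function.uncurry F)) (hG : Measurable (Function.uncurry G))
    (houtF : ∫⁻ μ, ∫⁻ y, F μ y ∂μ ∂P ≠ ∞) (houtG : ∫⁻ μ, ∫⁻ y, G μ y ∂μ ∂P ≠ ∞) :
    Integrable (fun μ => net F G μ) P ∧ ∫ μ, net F G μ ∂P = 0 := by
  obtain ⟨-, -, hIoF, hIiF, hFeq⟩ := integral_inflow_toReal_eq hδ hcore hstat hF houtF
  obtain ⟨-, -, hIoG, hIiG, hGeq⟩ := integral_inflow_toReal_eq hδ hcore hstat hG houtG
  have hIin : Integrable (fun μ => (∫⁻ y, F (μ.map fun z => z - y) (-y) ∂μ).toReal - (∫⁻ y, G (μ.map fun z => z - y) (-y) ∂μ).toReal) P :=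
    hIiF.sub hIiG
  have hIout : Integrable (fun μ => (∫⁻ y, F μ y ∂μ).toReal - (∫⁻ y, G μ y ∂μ).toReal) P := hIoF.sub hIoG
  refine ⟨hIin.sub hIout, ?_⟩
  show ∫ μ, ((∫⁻ y, F (μ.map fun z => z - y) (-y) ∂μ).toReal - (∫⁻ y, G (μ.map fun z => z - y) (-y) ∂μ).toReal) -
      ((∫⁻ y, F μ y ∂μ).toReal - (∫⁻ y, G μ y ∂μ).toReal) ∂P = 0
  rw [integral_sub hIin hIout, integral_sub hIiF hIiG, integral_sub hIoF hIoG, hFeq, hGeq, sub_self]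

/-- **A PRICE IN THE MEAN SUFFICES (signed form).**  Under the hypotheses of `integral_net_eq_zero`, if `c < E_P[rootEnergy V_LJ + net F G]` then
`c < E_P[rootEnergy V_LJ]`. [folklore] -/
theorem lt_integral_rootEnergy_of_meanSignedPrice (hδ : 0 < δ) [IsProbabilityMeasure P] (hcore : ∀ᵐ μ ∂P, IsRootedHardCore δ μ)
    (hstat : IsPointStationaryLaw P) (hF : Measurable (Function.uncurry F)) (hG : Measurable (Function.uncurry G))
    (houtF : ∫⁻ μ, ∫⁻ y, F μ y ∂μ ∂P ≠ ∞) (houtG : ∫⁻ μ, ∫⁻ y, G μ y ∂μ ∂P ≠ ∞) {c : ℝ}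
    (hprice : c < ∫ μ, rootEnergy lennardJones μ + net F G μ ∂P) : c < ∫ μ, rootEnergy lennardJones μ ∂P := by
  obtain ⟨hIn, h0⟩ := integral_net_eq_zero hδ hcore hstat hF hG houtF houtG
  have hIe : Integrable (fun μ => rootEnergy lennardJones μ) P := integrable_rootEnergy_of_ae_hardCore hδ hcore
  rwa [integral_add hIe hIn, h0, add_zero] at hprice

/-- **The non-strict mean form.** [folklore] -/
theorem le_integral_rootEnergy_of_meanSignedPrice (hδ : 0 < δ) [IsProbabilityMeasure P] (hcore : ∀ᵐ μ ∂P, IsRootedHardCore δ μ)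
    (hstat : IsPointStationaryLaw P) (hF : Measurable (Function.uncurry F)) (hG : Measurable (Function.uncurry G))
    (houtF : ∫⁻ μ, ∫⁻ y, F μ y ∂μ ∂P ≠ ∞) (houtG : ∫⁻ μ, ∫⁻ y, G μ y ∂μ ∂P ≠ ∞) {c : ℝ}
    (hprice : c ≤ ∫ μ, rootEnergy lennardJones μ + net F G μ ∂P) : c ≤ ∫ μ, rootEnergy lennardJones μ ∂P := by
  obtain ⟨hIn, h0⟩ := integral_net_eq_zero hδ hcore hstat hF hG houtF houtG
  have hIe : Integrable (fun μ => rootEnergy lennardJones μ) P := integrable_rootEnergy_of_ae_hardCore hδ hcore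
  rwa [integral_add hIe hIn, h0, add_zero] at hprice

/-- **THE SIGNED TRANSPORT LEMMA (pointwise, strict).**  If almost surely the redistributed root energy `rootEnergy V_LJ μ + net F G μ` is STRICTLY
above `c`, then `c < E_P[rootEnergy V_LJ]`.  (The tree lemma is the case `G = 0`.) [folklore] -/
theorem lt_integral_rootEnergy_of_signedTransport (hδ : 0 < δ) [IsProbabilityMeasure P] (hcore : ∀ᵐ μ ∂P, IsRootedHardCore δ μ)
    (hstat : IsPointStationaryLaw P) (hF : Measurable (Function.uncurry F)) (hG : Measurable (Function.uncurry G))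
    (houtF : ∫⁻ μ, ∫⁻ y, F μ y ∂μ ∂P ≠ ∞) (houtG : ∫⁻ μ, ∫⁻ y, G μ y ∂μ ∂P ≠ ∞) {c : ℝ}
    (hprice : ∀ᵐ μ ∂P, c < rootEnergy lennardJones μ + net F G μ) : c < ∫ μ, rootEnergy lennardJones μ ∂P := by
  obtain ⟨hIn, -⟩ := integral_net_eq_zero hδ hcore hstat hF hG houtF houtG
  have hIe : Integrable (fun μ => rootEnergy lennardJones μ) P := integrable_rootEnergy_of_ae_hardCore hδ hcore
  refine lt_integral_rootEnergy_of_meanSignedPrice hδ hcore hstat hF hG houtF houtG ?_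
  set g : Measure E3 → ℝ := fun μ => rootEnergy lennardJones μ + net F G μ with hg
  have hI : Integrable g P := hIe.add hIn
  have hIc : Integrable (fun μ => g μ - c) P := hI.sub (integrable_const c)
  have hnn : 0 ≤ᵐ[P] fun μ => g μ - c := by
    filter_upwards [hprice] with μ hμ
    exact sub_nonneg.mpr hμ.le
  by_contra hle
  have hle' : ∫ μ, g μ ∂P ≤ c := not_lt.mp hle
  have hzero : ∫ μ, g μ - c ∂P = 0 := by
    refine le_antisymm ?_ (integral_nonneg_of_ae hnn)
    rw [integral_sub hI (integrable_const c), integral_const, smul_eq_mul, probReal_univ, one_mul]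
    exact sub_nonpos.mpr hle'
  have hae : (fun μ => g μ - c) =ᵐ[P] 0 := (integral_eq_zero_iff_of_nonneg_ae hnn hIc).mp hzero
  have hfalse : ∀ᵐ μ ∂P, False := by
    filter_upwards [hprice, hae] with μ hμ h0
    have h0' : g μ - c = 0 := h0
    have hpos : 0 < g μ - c := sub_pos.mpr hμ
    rw [h0'] at hpos
    exact lt_irrefl 0 hpos
  exact IsProbabilityMeasure.ne_zero P (ae_eq_bot.mp (Filter.eventually_false_iff_eq_bot.mp hfalse))

/-! ## §2. By-name doors for the crux from a SIGNED law-level price (pointwise / in the mean) -/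

/-- **LAW-LEVEL SIGNED DOOR for the crux** (route decl, by name): for every hard core `δ > 0` and every admissible minimising law exhibit a SIGNED
covariant transport `F − G` (jointly measurable parts, finite mean out-flows) whose redistributed root energy is almost surely `> e⋆`. [folklore] -/
theorem aperiodicFrustratedLawGap_of_lawSignedTransportPrice
    (h : ∀ δ : ℝ, 0 < δ → ∀ P : MeasureTheory.Measure (MeasureTheory.Measure (EuclideanSpace ℝ (Fin 3))), let Gy : ℝ → (N : ℕ) → (Fin N → EuclideanSpace ℝ (Fin 3)) → Fin N → Prop := fun η N y j => let d : ℝ := sInf ((fun z => dist z (y (j : Fin N))) '' (Set.range (y) \ {(y (j : Fin N))})); let T : Set (EuclideanSpace ℝ (Fin 3)) := {z : EuclideanSpace ℝ (Fin 3) | z ∈ Set.range (y) ∧ z ≠ (y (j : Fin N)) ∧ dist z (y (j : Fin N)) < 13 / 10 * d}; ∃ A : EuclideanSpace ℝ (Fin 3) →ₗᵢ[ℝ] EuclideanSpace ℝ (Fin 3), (∃ e : ↥T ≃ ↥Literature.Geometry.DiscreteGeometry.fccKissingPattern, ∀ t : ↥T, dist (d⁻¹ • ((t : EuclideanSpace ℝ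 (Fin 3)) - (y (j : Fin N)))) (A ((e t : ↥Literature.Geometry.DiscreteGeometry.fccKissingPattern) : EuclideanSpace ℝ (Fin 3))) ≤ η) ∨ (∃ e : ↥T ≃ ↥Literature.Geometry.DiscreteGeometry.hcpKissingPattern, ∀ t : ↥T, dist (d⁻¹ • ((t : EuclideanSpace ℝ (Fin 3)) - (y (j : Fin N)))) (A ((e t : ↥Literature.Geometry.DiscreteGeometry.hcpKissingPattern) : EuclideanSpace ℝ (Fin 3))) ≤ η); let TexBall : (N : ℕ) → (Fin N → EuclideanSpace ℝ (Fin 3)) → Fin N → ℝ → ℝ → ℝ → ℝ → Prop := fun N y i R R₇ R₈ R₉ => (∀ a b : Fin N, a ≠ b → (7 : ℝ) / 10 ≤ dist (y a) (y b)) ∧ (∀ j : Fin N, dist (y j) (y i) ≤ R → ¬ Gy (1 / 20) N (y) j) ∧ (∀ j : Fin N, dist (y j) (y i) ≤ R → ¬ ((∀ j' : Fin N, dist (y j') (y j) ≤ R₇ → ¬ Gy (1 / 20) N (y) j') ∧ (∀ z : EuclideanSpace ℝ (Fin 3), dist z (y j) ≤ R₇ → ∃ k : Fin N, dist z (y k)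 ≤ 1) ∧ (∀ j' : Fin N, dist (y j') (y j) ≤ R₇ → (let d : ℝ := sInf ((fun z => dist z (y j')) '' (Set.range (y) \ {(y j')})); ∀ k : Fin N, y k ≠ y j' → dist (y k) (y j') < 27 / 20 * d → 5 ≤ Nat.card {m : Fin N // y m ≠ y j' ∧ dist (y m) (y j') < 27 / 20 * d ∧ y m ≠ y k ∧ dist (y m) (y k) < 27 / 20 * d})))) ∧ (∀ j : Fin N, dist (y j) (y i) ≤ R → ∃ k : Fin N, dist (y k) (y j) ≤ R₈ ∧ Gy (1 / 8) N (y) k) ∧ (∀ j : Fin N, dist (y j) (y i) ≤ R → ¬ ((∀ j' : Fin N, dist (y j') (y j) ≤ R₉ → ¬ Gy (1 / 20) N (y) j') ∧ (Nat.card {j' : Fin N // dist (y j') (y j) ≤ R₉ ∧ ¬ Gy (1 / 8) N (y) j'} : ℝ) ≤ 1 / 2 * (Nat.card {j' : Fin N // dist (y j') (y j) ≤ R₉} : ℝ) ∧ (∀ j' : Fin N, dist (y j') (y j) ≤ R₉ → ¬ Gy (1 / 8) N (y) j' → ¬ (let d : ℝ := sInf ((fun z => dist z (y j')) '' (Set.range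 (y) \ {(y j')})); ∀ k : Fin N, y k ≠ y j' → dist (y k) (y j') < 27 / 20 * d → 5 ≤ Nat.card {m : Fin N // y m ≠ y j' ∧ dist (y m) (y j') < 27 / 20 * d ∧ y m ≠ y k ∧ dist (y m) (y k) < 27 / 20 * d})))); let Appr : MeasureTheory.Measure (EuclideanSpace ℝ (Fin 3)) → ℝ → ℝ → ℝ → Prop := fun μ R₇ R₈ R₉ => ∀ q : EuclideanSpace ℝ (Fin 3), μ {q} ≠ 0 → ∀ R ε : ℝ, 0 < ε → ∃ (N : ℕ) (y : Fin N → EuclideanSpace ℝ (Fin 3)) (i : Fin N), TexBall N y i R R₇ R₈ R₉ ∧ (∀ p : EuclideanSpace ℝ (Fin 3), μ {p} ≠ 0 → dist p q ≤ R → ∃ k : Fin N, dist (y k - y i) (p - q) ≤ ε) ∧ (∀ k : Fin N, dist (y k) (y i) ≤ R → ∃ p : EuclideanSpace ℝ (Fin 3), μ {p} ≠ 0 ∧ dist (y k - y i) (p - q) ≤ ε); MeasureTheory.IsProbabilityMeasure P → (∀ᵐ μ ∂P, Literature.Probability.Process.IsRootedHardCore δ μ) → Literature.Probability.Process.IsPointStationaryLaw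 P → (∃ R₇ R₈ R₉ : ℝ, ∀ᵐ μ ∂P, Appr μ R₇ R₈ R₉) → (∀ᵐ μ ∂P, ∀ p : EuclideanSpace ℝ (Fin 3), μ {p} ≠ 0 → ∀ y : EuclideanSpace ℝ (Fin 3), (∀ q : EuclideanSpace ℝ (Fin 3), μ {q} ≠ 0 → q ≠ p → y ≠ q) → ∑' q : {q : EuclideanSpace ℝ (Fin 3) // μ {q} ≠ 0 ∧ q ≠ p}, Literature.MathematicalPhysics.StatisticalMechanics.lennardJones (dist p (q : EuclideanSpace ℝ (Fin 3))) ≤ ∑' q : {q : EuclideanSpace ℝ (Fin 3) // μ {q} ≠ 0 ∧ q ≠ p}, Literature.MathematicalPhysics.StatisticalMechanics.lennardJones (dist y (q : EuclideanSpace ℝ (Fin 3)))) → P {μ : MeasureTheory.Measure (EuclideanSpace ℝ (Fin 3)) | ∃ Q : Literature.MathematicalPhysics.StatisticalMechanics.PeriodicConfiguration 3, ∃ t : EuclideanSpace ℝ (Fin 3), {p : EuclideanSpace ℝ (Fin 3) | μ {p} ≠ 0} = (fun s => s + t) '' Q.points} = 0 → (∫ μ, Literature.MathematicalPhysics.StatisticalMechanics.rootEnergy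 Literature.MathematicalPhysics.StatisticalMechanics.lennardJones μ ∂P) ≤ (⨅ Q : Literature.MathematicalPhysics.StatisticalMechanics.PeriodicConfiguration 3, Q.energyPerParticle Literature.MathematicalPhysics.StatisticalMechanics.lennardJones) → ∃ F G : MeasureTheory.Measure (EuclideanSpace ℝ (Fin 3)) → EuclideanSpace ℝ (Fin 3) → ENNReal, Measurable (Function.uncurry F) ∧ Measurable (Function.uncurry G) ∧ (∫⁻ μ, ∫⁻ y, F μ y ∂μ ∂P) ≠ ⊤ ∧ (∫⁻ μ, ∫⁻ y, G μ y ∂μ ∂P) ≠ ⊤ ∧ (∀ᵐ μ ∂P, (⨅ Q : Literature.MathematicalPhysics.StatisticalMechanics.PeriodicConfiguration 3, Q.energyPerParticle Literature.MathematicalPhysics.StatisticalMechanics.lennardJones) < Literature.MathematicalPhysics.StatisticalMechanics.rootEnergy Literature.MathematicalPhysics.StatisticalMechanics.lennardJones μ + (((∫⁻ y, F (MeasureTheory.Measure.map (fun z : EuclideanSpace ℝ (Fin 3) => z - y) μ) (-y) ∂μ).toReal - (∫⁻ y, G (MeasureTheory.Measure.map (fun z : EuclideanSpace ℝ (Fin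 3) => z - y) μ) (-y) ∂μ).toReal) - ((∫⁻ y, F μ y ∂μ).toReal - (∫⁻ y, G μ y ∂μ).toReal)))) :
    Summit.AtomisticToContinuum.Crystallization.Theses.FrustratedLawDichotomy.AperiodicFrustratedLawGap := by
  intro δ hδ P
  have h' := h δ hδ P
  dsimp only at h' ⊢
  intro hP ha hb hd he h0
  by_contra hlt
  obtain ⟨F, G, hF, hG, houtF, houtG, hprice⟩ := h' hP ha hb hd he h0 (not_lt.mp hlt)
  exact hlt (lt_integral_rootEnergy_of_signedTransport hδ ha hb hF hG houtF houtG hprice)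

/-- **LAW-LEVEL MEAN-PRICE DOOR for the crux** (route decl, by name): the same with the price only IN THE MEAN,
`e⋆ < E_P[rootEnergy + net F G]` — the form the E′ ledger delivers (critic r1664 (C3) «AVERAGE, DON'T BOUND»). [folklore] -/
theorem aperiodicFrustratedLawGap_of_lawMeanSignedPrice
    (h : ∀ δ : ℝ, 0 < δ → ∀ P : MeasureTheory.Measure (MeasureTheory.Measure (EuclideanSpace ℝ (Fin 3))), let Gy : ℝ → (N : ℕ) → (Fin N → EuclideanSpace ℝ (Fin 3)) → Fin N → Prop := fun η N y j => let d : ℝ := sInf ((fun z => dist z (y (j : Fin N))) '' (Set.range (y) \ {(y (j : Fin N))})); let T : Set (EuclideanSpace ℝ (Fin 3)) := {z : EuclideanSpace ℝ (Fin 3) | z ∈ Set.range (y) ∧ z ≠ (y (j : Fin N)) ∧ dist z (y (j : Fin N)) < 13 / 10 * d}; ∃ A : EuclideanSpace ℝ (Fin 3) →ₗᵢ[ℝ] EuclideanSpace ℝ (Fin 3), (∃ e : ↥T ≃ ↥Literature.Geometry.DiscreteGeometry.fccKissingPattern, ∀ t : ↥T, dist (d⁻¹ • ((t : EuclideanSpace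 ℝ (Fin 3)) - (y (j : Fin N)))) (A ((e t : ↥Literature.Geometry.DiscreteGeometry.fccKissingPattern) : EuclideanSpace ℝ (Fin 3))) ≤ η) ∨ (∃ e : ↥T ≃ ↥Literature.Geometry.DiscreteGeometry.hcpKissingPattern, ∀ t : ↥T, dist (d⁻¹ • ((t : EuclideanSpace ℝ (Fin 3)) - (y (j : Fin N)))) (A ((e t : ↥Literature.Geometry.DiscreteGeometry.hcpKissingPattern) : EuclideanSpace ℝ (Fin 3))) ≤ η); let TexBall : (N : ℕ) → (Fin N → EuclideanSpace ℝ (Fin 3)) → Fin N → ℝ → ℝ → ℝ → ℝ → Prop := fun N y i R R₇ R₈ R₉ => (∀ a b : Fin N, a ≠ b → (7 : ℝ) / 10 ≤ dist (y a) (y b)) ∧ (∀ j : Fin N, dist (y j) (y i) ≤ R → ¬ Gy (1 / 20) N (y) j) ∧ (∀ j : Fin N, dist (y j) (y i) ≤ R → ¬ ((∀ j' : Fin N, dist (y j') (y j) ≤ R₇ → ¬ Gy (1 / 20) N (y) j') ∧ (∀ z : EuclideanSpace ℝ (Fin 3), dist z (y j) ≤ R₇ → ∃ k : Fin N, dist z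 (y k) ≤ 1) ∧ (∀ j' : Fin N, dist (y j') (y j) ≤ R₇ → (let d : ℝ := sInf ((fun z => dist z (y j')) '' (Set.range (y) \ {(y j')})); ∀ k : Fin N, y k ≠ y j' → dist (y k) (y j') < 27 / 20 * d → 5 ≤ Nat.card {m : Fin N // y m ≠ y j' ∧ dist (y m) (y j') < 27 / 20 * d ∧ y m ≠ y k ∧ dist (y m) (y k) < 27 / 20 * d})))) ∧ (∀ j : Fin N, dist (y j) (y i) ≤ R → ∃ k : Fin N, dist (y k) (y j) ≤ R₈ ∧ Gy (1 / 8) N (y) k) ∧ (∀ j : Fin N, dist (y j) (y i) ≤ R → ¬ ((∀ j' : Fin N, dist (y j') (y j) ≤ R₉ → ¬ Gy (1 / 20) N (y) j') ∧ (Nat.card {j' : Fin N // dist (y j') (y j) ≤ R₉ ∧ ¬ Gy (1 / 8) N (y) j'} : ℝ) ≤ 1 / 2 * (Nat.card {j' : Fin N // dist (y j') (y j) ≤ R₉} : ℝ) ∧ (∀ j' : Fin N, dist (y j') (y j) ≤ R₉ → ¬ Gy (1 / 8) N (y) j' → ¬ (let d : ℝ := sInf ((fun z => dist z (y j')) ''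 (Set.range (y) \ {(y j')})); ∀ k : Fin N, y k ≠ y j' → dist (y k) (y j') < 27 / 20 * d → 5 ≤ Nat.card {m : Fin N // y m ≠ y j' ∧ dist (y m) (y j') < 27 / 20 * d ∧ y m ≠ y k ∧ dist (y m) (y k) < 27 / 20 * d})))); let Appr : MeasureTheory.Measure (EuclideanSpace ℝ (Fin 3)) → ℝ → ℝ → ℝ → Prop := fun μ R₇ R₈ R₉ => ∀ q : EuclideanSpace ℝ (Fin 3), μ {q} ≠ 0 → ∀ R ε : ℝ, 0 < ε → ∃ (N : ℕ) (y : Fin N → EuclideanSpace ℝ (Fin 3)) (i : Fin N), TexBall N y i R R₇ R₈ R₉ ∧ (∀ p : EuclideanSpace ℝ (Fin 3), μ {p} ≠ 0 → dist p q ≤ R → ∃ k : Fin N, dist (y k - y i) (p - q) ≤ ε) ∧ (∀ k : Fin N, dist (y k) (y i) ≤ R → ∃ p : EuclideanSpace ℝ (Fin 3), μ {p} ≠ 0 ∧ dist (y k - y i) (p - q) ≤ ε); MeasureTheory.IsProbabilityMeasure P → (∀ᵐ μ ∂P, Literature.Probability.Process.IsRootedHardCore δ μ) → Literature.Probability.Process.IsPointStationaryLaw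 P → (∃ R₇ R₈ R₉ : ℝ, ∀ᵐ μ ∂P, Appr μ R₇ R₈ R₉) → (∀ᵐ μ ∂P, ∀ p : EuclideanSpace ℝ (Fin 3), μ {p} ≠ 0 → ∀ y : EuclideanSpace ℝ (Fin 3), (∀ q : EuclideanSpace ℝ (Fin 3), μ {q} ≠ 0 → q ≠ p → y ≠ q) → ∑' q : {q : EuclideanSpace ℝ (Fin 3) // μ {q} ≠ 0 ∧ q ≠ p}, Literature.MathematicalPhysics.StatisticalMechanics.lennardJones (dist p (q : EuclideanSpace ℝ (Fin 3))) ≤ ∑' q : {q : EuclideanSpace ℝ (Fin 3) // μ {q} ≠ 0 ∧ q ≠ p}, Literature.MathematicalPhysics.StatisticalMechanics.lennardJones (dist y (q : EuclideanSpace ℝ (Fin 3)))) → P {μ : MeasureTheory.Measure (EuclideanSpace ℝ (Fin 3)) | ∃ Q : Literature.MathematicalPhysics.StatisticalMechanics.PeriodicConfiguration 3, ∃ t : EuclideanSpace ℝ (Fin 3), {p : EuclideanSpace ℝ (Fin 3) | μ {p} ≠ 0} = (fun s => s + t) '' Q.points} = 0 → (∫ μ, Literature.MathematicalPhysics.StatisticalMechanics.rootEnergy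 Literature.MathematicalPhysics.StatisticalMechanics.lennardJones μ ∂P) ≤ (⨅ Q : Literature.MathematicalPhysics.StatisticalMechanics.PeriodicConfiguration 3, Q.energyPerParticle Literature.MathematicalPhysics.StatisticalMechanics.lennardJones) → ∃ F G : MeasureTheory.Measure (EuclideanSpace ℝ (Fin 3)) → EuclideanSpace ℝ (Fin 3) → ENNReal, Measurable (Function.uncurry F) ∧ Measurable (Function.uncurry G) ∧ (∫⁻ μ, ∫⁻ y, F μ y ∂μ ∂P) ≠ ⊤ ∧ (∫⁻ μ, ∫⁻ y, G μ y ∂μ ∂P) ≠ ⊤ ∧ (⨅ Q : Literature.MathematicalPhysics.StatisticalMechanics.PeriodicConfiguration 3, Q.energyPerParticle Literature.MathematicalPhysics.StatisticalMechanics.lennardJones) < ∫ μ, Literature.MathematicalPhysics.StatisticalMechanics.rootEnergy Literature.MathematicalPhysics.StatisticalMechanics.lennardJones μ + net F G μ ∂P) :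
    Summit.AtomisticToContinuum.Crystallization.Theses.FrustratedLawDichotomy.AperiodicFrustratedLawGap := by
  intro δ hδ P
  have h' := h δ hδ P
  dsimp only at h' ⊢
  intro hP ha hb hd he h0
  by_contra hlt
  obtain ⟨F, G, hF, hG, houtF, houtG, hprice⟩ := h' hP ha hb hd he h0 (not_lt.mp hlt)
  exact hlt (lt_integral_rootEnergy_of_meanSignedPrice hδ ha hb hF hG houtF houtG hprice)

/-! ## §3. The law-level LEDGER (Reading 2 «ledger first», priced by two pointwise floors and ONE mean inequality) -/

/-- **A signed ledger for the law `P` at level `c`.**  Data: a signed covariant transport `F − G` (jointly measurable parts of finite mean out-flow);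
a measurable set `good` of (chartable) rooted configurations; a credit `γ` booked at good roots (host-gap floor) and `σ` at bad roots (H-side
surplus floor) AFTER redistribution, each up to an integrable charge (`q` at good roots: second-order displacement energy + chart mismatch; `r` at bad
roots: the interface flux landing there); and `coercive` — the local-stiffness / dual certificates averaged: the mean charges are STRICTLY below the
booked credit `γ·P(good) + σ·P(bad)`.  No sign conditions on `γ σ q r` are needed. [new: bookkeeping schema of the E′ line] -/
structure LawLedger (P : Measure (Measure E3)) (c : ℝ) where
  /-- forward part of the signed transport -/
  F : Measure E3 → E3 → ℝ≥0∞
  /-- backward part of the signed transport -/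
  G : Measure E3 → E3 → ℝ≥0∞
  measF : Measurable (Function.uncurry F)
  measG : Measurable (Function.uncurry G)
  outF_ne_top : ∫⁻ μ, ∫⁻ y, F μ y ∂μ ∂P ≠ ∞
  outG_ne_top : ∫⁻ μ, ∫⁻ y, G μ y ∂μ ∂P ≠ ∞
  /-- the chartable (good) rooted configurations -/
  good : Set (Measure E3)
  good_meas : MeasurableSet good
  /-- credit booked at good roots (host-gap floor) -/
  γ : ℝ
  /-- credit booked at bad roots (surplus floor) -/
  σ : ℝ
  /-- charge at good roots (second order + mismatch) -/
  q : Measure E3 → ℝ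
  /-- charge at bad roots (interface flux debit) -/
  r : Measure E3 → ℝ
  q_int : Integrable q P
  r_int : Integrable r P
  /-- `GoodGapFloor ∧ MismatchControl`, pointwise at good roots after redistribution -/
  floor_good : ∀ᵐ μ ∂P, μ ∈ good → c + γ - q μ ≤ rootEnergy lennardJones μ + net F G μ
  /-- `BadSurplusFloor ∧ BadInflowFloor`, pointwise at bad roots after redistribution -/
  floor_bad : ∀ᵐ μ ∂P, μ ∉ good → c + σ - r μ ≤ rootEnergy lennardJones μ + net F G μ
  /-- `AvgCoercivity` (the averaged dual certificates): mean charges < booked credit -/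
  coercive : (∫ μ in good, q μ ∂P) + (∫ μ in goodᶜ, r μ ∂P) < γ * P.real good + σ * P.real goodᶜ

/-- **THE LEDGER PRICES THE MEAN.**  Any signed ledger at level `c` for a point-stationary probability law almost surely carried by rooted
`δ`-hard-core configurations forces `c < E_P[rootEnergy V_LJ]`: integrate the two floors against the partition `good / goodᶜ`, use `coercive`,
and cancel the net flow by `integral_net_eq_zero`. [new: bookkeeping] -/
theorem LawLedger.lt_integral_rootEnergy {c : ℝ} [IsProbabilityMeasure P] (L : LawLedger P c) (hδ : 0 < δ)
    (hcore : ∀ᵐ μ ∂P, IsRootedHardCore δ μ) (hstat : IsPointStationaryLaw P) : c < ∫ μ, rootEnergy lennardJones μ ∂P := by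
  obtain ⟨hIn, -⟩ := integral_net_eq_zero hδ hcore hstat L.measF L.measG L.outF_ne_top L.outG_ne_top
  have hIe : Integrable (fun μ => rootEnergy lennardJones μ) P := integrable_rootEnergy_of_ae_hardCore hδ hcore
  refine lt_integral_rootEnergy_of_meanSignedPrice hδ hcore hstat L.measF L.measG L.outF_ne_top L.outG_ne_top ?_
  have hIgq : Integrable (fun μ => L.γ - L.q μ) P := (integrable_const _).sub L.q_int
  have hIsr : Integrable (fun μ => L.σ - L.r μ) P := (integrable_const _).sub L.r_int
  have hI1 : Integrable (L.good.indicator fun μ => L.γ - L.q μ) P := hIgq.indicator L.good_meas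
  have hI2 : Integrable (L.goodᶜ.indicator fun μ => L.σ - L.r μ) P := hIsr.indicator L.good_meas.compl
  have hI12 : Integrable (fun μ => (L.good.indicator fun μ => L.γ - L.q μ) μ + (L.goodᶜ.indicator fun μ => L.σ - L.r μ) μ) P := hI1.add hI2
  have hIb : Integrable (fun μ => c + ((L.good.indicator fun μ => L.γ - L.q μ) μ + (L.goodᶜ.indicator fun μ => L.σ - L.r μ) μ)) P :=
    (integrable_const c).add hI12
  have hIen : Integrable (fun μ => rootEnergy lennardJones μ + net L.F L.G μ) P := hIe.add hIn
  -- the lower envelope and its integral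
  have hle : (fun μ => c + ((L.good.indicator fun μ => L.γ - L.q μ) μ + (L.goodᶜ.indicator fun μ => L.σ - L.r μ) μ)) ≤ᵐ[P]
      fun μ => rootEnergy lennardJones μ + net L.F L.G μ := by
    filter_upwards [L.floor_good, L.floor_bad] with μ hg hb
    by_cases hμ : μ ∈ L.good
    · have h1 : (L.good.indicator fun μ => L.γ - L.q μ) μ = L.γ - L.q μ := Set.indicator_of_mem hμ _
      have h2 : (L.goodᶜ.indicator fun μ => L.σ - L.r μ) μ = 0 := Set.indicator_of_notMem (Set.notMem_compl_iff.mpr hμ) _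
      rw [h1, h2, add_zero]
      linarith [hg hμ]
    · have h1 : (L.good.indicator fun μ => L.γ - L.q μ) μ = 0 := Set.indicator_of_notMem hμ _
      have h2 : (L.goodᶜ.indicator fun μ => L.σ - L.r μ) μ = L.σ - L.r μ := Set.indicator_of_mem (Set.mem_compl hμ) _
      rw [h1, h2, zero_add]
      linarith [hb hμ]
  have hq1 : ∫ μ in L.good, L.γ - L.q μ ∂P = L.γ * P.real L.good - ∫ μ in L.good, L.q μ ∂P := by
    rw [integral_sub (integrable_const _) L.q_int.integrableOn, setIntegral_const, smul_eq_mul, mul_comm]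
  have hr1 : ∫ μ in L.goodᶜ, L.σ - L.r μ ∂P = L.σ * P.real L.goodᶜ - ∫ μ in L.goodᶜ, L.r μ ∂P := by
    rw [integral_sub (integrable_const _) L.r_int.integrableOn, setIntegral_const, smul_eq_mul, mul_comm]
  have henv : ∫ μ, c + ((L.good.indicator fun μ => L.γ - L.q μ) μ + (L.goodᶜ.indicator fun μ => L.σ - L.r μ) μ) ∂P =
      c + ((L.γ * P.real L.good - ∫ μ in L.good, L.q μ ∂P) + (L.σ * P.real L.goodᶜ - ∫ μ in L.goodᶜ, L.r μ ∂P)) := by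
    rw [integral_add (integrable_const c) hI12, integral_const, smul_eq_mul, probReal_univ, one_mul,
      integral_add hI1 hI2, integral_indicator L.good_meas, integral_indicator L.good_meas.compl, hq1, hr1]
  have hmono : ∫ μ, c + ((L.good.indicator fun μ => L.γ - L.q μ) μ + (L.goodᶜ.indicator fun μ => L.σ - L.r μ) μ) ∂P ≤
      ∫ μ, rootEnergy lennardJones μ + net L.F L.G μ ∂P := integral_mono_ae hIb hIen hle
  rw [henv] at hmono
  have hco := L.coercive
  linarith

/-- **Monotonicity in the level**: a ledger at level `c` is a ledger at every level `c' ≤ c`. [new: bookkeeping] -/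
def LawLedger.mono {c c' : ℝ} (L : LawLedger P c) (hc : c' ≤ c) : LawLedger P c' where
  F := L.F
  G := L.G
  measF := L.measF
  measG := L.measG
  outF_ne_top := L.outF_ne_top
  outG_ne_top := L.outG_ne_top
  good := L.good
  good_meas := L.good_meas
  γ := L.γ
  σ := L.σ
  q := L.q
  r := L.r
  q_int := L.q_int
  r_int := L.r_int
  floor_good := by
    filter_upwards [L.floor_good] with μ hμ hg
    linarith [hμ hg]
  floor_bad := by
    filter_upwards [L.floor_bad] with μ hμ hb
    linarith [hμ hb]
  coercive := L.coercive

/-- **Non-vacuity / base case of the schema**: a UNIFORM pointwise signed price `c + γ ≤ rootEnergy V_LJ + net F G` almost surely, with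
`γ > 0`, is a ledger at level `c` (every root good, no charges) — so `aperiodicFrustratedLawGap_of_lawLedger` contains the pointwise doors of §2
up to the uniformity of the margin. [new: bookkeeping] -/
def LawLedger.ofPointwise [IsProbabilityMeasure P] {c γ : ℝ} (hγ : 0 < γ) (hF : Measurable (Function.uncurry F))
    (hG : Measurable (Function.uncurry G)) (houtF : ∫⁻ μ, ∫⁻ y, F μ y ∂μ ∂P ≠ ∞) (houtG : ∫⁻ μ, ∫⁻ y, G μ y ∂μ ∂P ≠ ∞)
    (hprice : ∀ᵐ μ ∂P, c + γ ≤ rootEnergy lennardJones μ + net F G μ) : LawLedger P c where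
  F := F
  G := G
  measF := hF
  measG := hG
  outF_ne_top := houtF
  outG_ne_top := houtG
  good := Set.univ
  good_meas := MeasurableSet.univ
  γ := γ
  σ := 0
  q := fun _ => 0
  r := fun _ => 0
  q_int := integrable_const 0
  r_int := integrable_const 0
  floor_good := by
    filter_upwards [hprice] with μ hμ _
    linarith
  floor_bad := ae_of_all _ fun μ hμ => absurd (Set.mem_univ μ) hμ
  coercive := by
    simp only [integral_zero, add_zero, Set.compl_univ, probReal_univ, mul_one, zero_mul]
    exact hγ

/-! ## §4. By-name door for the crux from a LEDGER for every admissible minimising law -/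

/-- **LAW-LEVEL LEDGER DOOR for the crux** (route decl, by name).  Suppose that for every hard core `δ > 0` and every point-stationary probability
law `P` that is almost surely rooted `δ`-hard-core, texture-charged (`Appr μ R₇ R₈ R₉`), Nash at every atom, almost surely not a periodic translate and
MINIMISING (`E_P[rootEnergy] ≤ e⋆`) there is a signed ledger `LawLedger P e⋆`.  Then `AperiodicFrustratedLawGap` holds. [new: junction] -/
theorem aperiodicFrustratedLawGap_of_lawLedger
    (h : ∀ δ : ℝ, 0 < δ → ∀ P : MeasureTheory.Measure (MeasureTheory.Measure (EuclideanSpace ℝ (Fin 3))), let Gy : ℝ → (N : ℕ) → (Fin N → EuclideanSpace ℝ (Fin 3)) → Fin N → Prop := fun η N y j => let d : ℝ := sInf ((fun z => dist z (y (j : Fin N))) '' (Set.range (y) \ {(y (j : Fin N))})); let T : Set (EuclideanSpace ℝ (Fin 3)) := {z : EuclideanSpace ℝ (Fin 3) | z ∈ Set.range (y) ∧ z ≠ (y (j : Fin N)) ∧ dist z (y (j : Fin N)) < 13 / 10 * d}; ∃ A : EuclideanSpace ℝ (Fin 3) →ₗᵢ[ℝ] EuclideanSpace ℝ (Fin 3),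 (∃ e : ↥T ≃ ↥Literature.Geometry.DiscreteGeometry.fccKissingPattern, ∀ t : ↥T, dist (d⁻¹ • ((t : EuclideanSpace ℝ (Fin 3)) - (y (j : Fin N)))) (A ((e t : ↥Literature.Geometry.DiscreteGeometry.fccKissingPattern) : EuclideanSpace ℝ (Fin 3))) ≤ η) ∨ (∃ e : ↥T ≃ ↥Literature.Geometry.DiscreteGeometry.hcpKissingPattern, ∀ t : ↥T, dist (d⁻¹ • ((t : EuclideanSpace ℝ (Fin 3)) - (y (j : Fin N)))) (A ((e t : ↥Literature.Geometry.DiscreteGeometry.hcpKissingPattern) : EuclideanSpace ℝ (Fin 3))) ≤ η); let TexBall : (N : ℕ) → (Fin N → EuclideanSpace ℝ (Fin 3)) → Fin N → ℝ → ℝ → ℝ → ℝ → Prop := fun N y i R R₇ R₈ R₉ => (∀ a b : Fin N, a ≠ b → (7 : ℝ) / 10 ≤ dist (y a) (y b)) ∧ (∀ j : Fin N, dist (y j) (y i) ≤ R → ¬ Gy (1 / 20) N (y) j) ∧ (∀ j : Fin N, dist (y j) (y i) ≤ R → ¬ ((∀ j' : Fin N, dist (y j') (y j) ≤ R₇ →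 ¬ Gy (1 / 20) N (y) j') ∧ (∀ z : EuclideanSpace ℝ (Fin 3), dist z (y j) ≤ R₇ → ∃ k : Fin N, dist z (y k) ≤ 1) ∧ (∀ j' : Fin N, dist (y j') (y j) ≤ R₇ → (let d : ℝ := sInf ((fun z => dist z (y j')) '' (Set.range (y) \ {(y j')})); ∀ k : Fin N, y k ≠ y j' → dist (y k) (y j') < 27 / 20 * d → 5 ≤ Nat.card {m : Fin N // y m ≠ y j' ∧ dist (y m) (y j') < 27 / 20 * d ∧ y m ≠ y k ∧ dist (y m) (y k) < 27 / 20 * d})))) ∧ (∀ j : Fin N, dist (y j) (y i) ≤ R → ∃ k : Fin N, dist (y k) (y j) ≤ R₈ ∧ Gy (1 / 8) N (y) k) ∧ (∀ j : Fin N, dist (y j) (y i) ≤ R → ¬ ((∀ j' : Fin N, dist (y j') (y j) ≤ R₉ → ¬ Gy (1 / 20) N (y) j') ∧ (Nat.card {j' : Fin N // dist (y j') (y j) ≤ R₉ ∧ ¬ Gy (1 / 8) N (y) j'} : ℝ) ≤ 1 / 2 * (Nat.card {j' : Fin N // dist (y j') (y j) ≤ R₉} : ℝ) ∧ (∀ j'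 : Fin N, dist (y j') (y j) ≤ R₉ → ¬ Gy (1 / 8) N (y) j' → ¬ (let d : ℝ := sInf ((fun z => dist z (y j')) '' (Set.range (y) \ {(y j')})); ∀ k : Fin N, y k ≠ y j' → dist (y k) (y j') < 27 / 20 * d → 5 ≤ Nat.card {m : Fin N // y m ≠ y j' ∧ dist (y m) (y j') < 27 / 20 * d ∧ y m ≠ y k ∧ dist (y m) (y k) < 27 / 20 * d})))); let Appr : MeasureTheory.Measure (EuclideanSpace ℝ (Fin 3)) → ℝ → ℝ → ℝ → Prop := fun μ R₇ R₈ R₉ => ∀ q : EuclideanSpace ℝ (Fin 3), μ {q} ≠ 0 → ∀ R ε : ℝ, 0 < ε → ∃ (N : ℕ) (y : Fin N → EuclideanSpace ℝ (Fin 3)) (i : Fin N), TexBall N y i R R₇ R₈ R₉ ∧ (∀ p : EuclideanSpace ℝ (Fin 3), μ {p} ≠ 0 → dist p q ≤ R → ∃ k : Fin N, dist (y k - y i) (p - q) ≤ ε) ∧ (∀ k : Fin N, dist (y k) (y i) ≤ R → ∃ p : EuclideanSpace ℝ (Fin 3), μ {p} ≠ 0 ∧ dist (y k - y i) (p - q)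 ≤ ε); MeasureTheory.IsProbabilityMeasure P → (∀ᵐ μ ∂P, Literature.Probability.Process.IsRootedHardCore δ μ) → Literature.Probability.Process.IsPointStationaryLaw P → (∃ R₇ R₈ R₉ : ℝ, ∀ᵐ μ ∂P, Appr μ R₇ R₈ R₉) → (∀ᵐ μ ∂P, ∀ p : EuclideanSpace ℝ (Fin 3), μ {p} ≠ 0 → ∀ y : EuclideanSpace ℝ (Fin 3), (∀ q : EuclideanSpace ℝ (Fin 3), μ {q} ≠ 0 → q ≠ p → y ≠ q) → ∑' q : {q : EuclideanSpace ℝ (Fin 3) // μ {q} ≠ 0 ∧ q ≠ p}, Literature.MathematicalPhysics.StatisticalMechanics.lennardJones (dist p (q : EuclideanSpace ℝ (Fin 3))) ≤ ∑' q : {q : EuclideanSpace ℝ (Fin 3) // μ {q} ≠ 0 ∧ q ≠ p}, Literature.MathematicalPhysics.StatisticalMechanics.lennardJones (dist y (q : EuclideanSpace ℝ (Fin 3)))) → P {μ : MeasureTheory.Measure (EuclideanSpace ℝ (Fin 3)) | ∃ Q : Literature.MathematicalPhysics.StatisticalMechanics.PeriodicConfiguration 3, ∃ t : EuclideanSpace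 ℝ (Fin 3), {p : EuclideanSpace ℝ (Fin 3) | μ {p} ≠ 0} = (fun s => s + t) '' Q.points} = 0 → (∫ μ, Literature.MathematicalPhysics.StatisticalMechanics.rootEnergy Literature.MathematicalPhysics.StatisticalMechanics.lennardJones μ ∂P) ≤ (⨅ Q : Literature.MathematicalPhysics.StatisticalMechanics.PeriodicConfiguration 3, Q.energyPerParticle Literature.MathematicalPhysics.StatisticalMechanics.lennardJones) → Nonempty (LawLedger P (⨅ Q : Literature.MathematicalPhysics.StatisticalMechanics.PeriodicConfiguration 3, Q.energyPerParticle Literature.MathematicalPhysics.StatisticalMechanics.lennardJones))) :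
    Summit.AtomisticToContinuum.Crystallization.Theses.FrustratedLawDichotomy.AperiodicFrustratedLawGap := by
  intro δ hδ P
  have h' := h δ hδ P
  dsimp only at h' ⊢
  intro hP ha hb hd he h0
  by_contra hlt
  obtain ⟨L⟩ := h' hP ha hb hd he h0 (not_lt.mp hlt)
  exact hlt (L.lt_integral_rootEnergy hδ ha hb)

end Summit.AtomisticToContinuum.Crystallization.Theorems.FrustratedLawDichotomySignedLedger

end
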